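import Mathlib
import Summits.KontsevichZagierPeriods.Zeta5Search.Certificates.RecordRayRaySteps
import HarnessLib

/-!
# The chain rule of the coefficient frame along the record ray (fam-tele g15, S4-R1 file 2 = blueprint K3)

HONEST FRAMING: systematic search; no irrationality claim unless certified.  Exact algebra about the
coefficient frame of Brown–Zudilin's record cell along the ray `a·n`; NOTHING here is a statement about the
size of a linear form, a denominator, or the arithmetic nature of `ζ(5)`.

**Theorem (`realFrame_chain`).** For every `n ≥ 1` the real frames `T_ℝ(b_n)` (`RecordRayConnection.realFrame`,
rows `b_n, b_n+e₇, b_n+2e₇`, columns `U, W, F̃₇`) of consecutive record points `b_n = n·(41;17,…,11)` satisfy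
`T_ℝ(b_{n+1}) = c_n • P̃(n) • T_ℝ(b_n)` with `P̃(n) = Pgen n` the INTEGER PERIOD MATRIX of
`RecordRayGenericSteps` (a fixed product of 66 closed-form step matrices and one adjugate, entries integer
polynomials in `n`) and `c_n = sA(n)/(det Ã(n)·sB(n)) ≠ 0` (`cRec_ne`).  Also: the rational version
`frame_chain`, `det T_ℝ(b_n) ≠ 0` (`realFrame_bRecord_det_ne`).

Proof = the 66-step period of fam-tele g14 `conn/PATH.md` (45 lowerings `b_n → z_n = b_n − (0;3,4,5,7,8,8,10)`,
read as RAISE steps upward, then `H` and 20 diagonal shifts `z_n → b_{n+1}`), each step an instance of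
`RecordRayRaySteps.lower_step/ds_step/h_step`; ALL 4414 affine side conditions are discharged by four `decide`s
(`chainA_chk`, `hB_chk`, `chainB_chk`, `ends_chk`).  This is the hypothesis `hstep` of
`RecordRayConnection.frequently_ne_zero_of_window` (clause (N) in window form) and the input of the Apéry-type
recursion (clause (E)); see `RecordRayWindow`.
-/

namespace Summit.KontsevichZagierPeriods.Zeta5Search.RecordRay.Generic

open Finset Matrix
open Summit.KontsevichZagierPeriods.Zeta5Search.DualSeries (InBox)
open Summit.KontsevichZagierPeriods.Zeta5Search.WedgeDictionary
open Summit.KontsevichZagierPeriods.Zeta5Search.Elimination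
open Summit.KontsevichZagierPeriods.Zeta5Search.DualSeriesLemma19 (bRecord)
open Summit.KontsevichZagierPeriods.Zeta5Search.RecordRay.Connection

/-! ### 1. The four certificates (all side conditions of the 66 steps, every `n ≥ 1`) -/

/-- Kernel check (`decide`): every step of the A-half passes its checker, for all `ν ≥ 1` (affine tables). -/
theorem chainA_chk : ((List.range 45).all fun k => lowerChk (betaA k) (betaA (k + 1)) (slotA k)) = true := by
  decide +kernel

/-- Kernel check (`decide`): the `H` step between the halves passes its checker. -/
theorem hB_chk : hChk (betaB 0) (betaB 1) = true := by decide +kernel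

/-- Kernel check (`decide`): every step of the B-half passes its checker. -/
theorem chainB_chk : ((List.range 20).all fun k => dsChk (betaB (k + 1)) (betaB (k + 2))) = true := by
  decide +kernel

/-- Kernel check (`decide`): the path starts at `bRecord ν` and ends at `bRecord (ν+1)`. -/
theorem ends_chk : (ptChk (betaA 45) && pairChk (betaA 45)) = true := by decide +kernel

/-- The last point of the A-half. -/
theorem betaA_last : betaA 45 = [0, 0, 0, 0, 0, 0, 0, 0] := by decide +kernel

/-- The first point of the B-half. -/
theorem betaB_zero : betaB 0 = betaA 0 := by decide +kernel

/-- The last point of the B-half. -/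
theorem betaB_last : betaB 21 = [41, 17, 16, 15, 14, 13, 12, 11] := by decide +kernel

/-! ### 2. The steps and the two transports -/

/-- One certified step of the A-half: `T(next point) = c • (M · T(point))`. -/
theorem stepA {n : ℕ} (hn : 1 ≤ n) (k : ℕ) (hk : k < 45) :
    matA (n : ℚ) k * frameMat (rayPt (betaA k) n) = sigA (n : ℚ) k • frameMat (rayPt (betaA (k + 1)) n) :=
  lower_step (List.all_eq_true.1 chainA_chk k (List.mem_range.2 hk)) hn

/-- One certified step of the B-half: `T(next point) = c • (M · T(point))`. -/
theorem stepB {n : ℕ} (hn : 1 ≤ n) (k : ℕ) (hk : k < 21) :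
    matB (n : ℚ) k * frameMat (rayPt (betaB k) n) = sigB (n : ℚ) k • frameMat (rayPt (betaB (k + 1)) n) := by
  rcases Nat.eq_zero_or_pos k with rfl | hk0
  · simp only [matB, sigB, if_true]
    exact h_step hB_chk hn
  · obtain ⟨j, rfl⟩ : ∃ j, k = j + 1 := ⟨k - 1, by omega⟩
    simp only [matB, sigB, Nat.add_one_ne_zero, if_false]
    exact ds_step (List.all_eq_true.1 chainB_chk j (List.mem_range.2 (by omega))) hn

/-- `Ã(n)·T(z_n) = sA(n)·T(p₀)` (the lowering half, read upward). -/
theorem transportA {n : ℕ} (hn : 1 ≤ n) :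
    prodA (n : ℚ) * frameMat (rayPt (betaA 0) n) = sA (n : ℚ) • frameMat (rayPt (betaA 45) n) :=
  chainProd_mul (matA (n : ℚ)) (fun k => frameMat (rayPt (betaA k) n)) (sigA (n : ℚ)) 45 (fun k hk => stepA hn k hk)

/-- `B̃(n)·T(z_n) = sB(n)·T(b_{n+1})` (the raising half). -/
theorem transportB {n : ℕ} (hn : 1 ≤ n) :
    prodB (n : ℚ) * frameMat (rayPt (betaB 0) n) = sB (n : ℚ) • frameMat (rayPt (betaB 21) n) :=
  chainProd_mul (matB (n : ℚ)) (fun k => frameMat (rayPt (betaB k) n)) (sigB (n : ℚ)) 21 (fun k hk => stepB hn k hk)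

/-! ### 3. The end points are the record points -/

/-- `bRecord n` is the ray point at `ν = n`. -/
theorem bRecord_eq_rayPt (m : ℕ) : bRecord m = rayPt [0, 0, 0, 0, 0, 0, 0, 0] m := by
  funext j
  rcases Nat.lt_or_ge j 8 with hj | hj
  · interval_cases j <;> simp [bRecord, rayPt, rayDir]
  · have h0 : j ≠ 0 := by omega
    have h7 : ¬ j ≤ 7 := by omega
    have hr : rayDir.length ≤ j := by simp [rayDir]; omega
    have hz : ([0, 0, 0, 0, 0, 0, 0, 0] : List ℤ).length ≤ j := by simp; omega
    simp [bRecord, rayPt, h0, h7, List.getElem?_eq_none hr, List.getElem?_eq_none hz]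

/-- The end of the period path is the next ray point. -/
theorem rayPt_last (n : ℕ) : rayPt (betaB 21) n = rayPt [0, 0, 0, 0, 0, 0, 0, 0] (n + 1) := by
  rw [betaB_last]
  funext j
  rcases Nat.lt_or_ge j 8 with hj | hj
  · interval_cases j <;> simp [rayPt, rayDir] <;> ring
  · have hr : rayDir.length ≤ j := by simp [rayDir]; omega
    have hz : ([0, 0, 0, 0, 0, 0, 0, 0] : List ℤ).length ≤ j := by simp; omega
    have hl : ([41, 17, 16, 15, 14, 13, 12, 11] : List ℤ).length ≤ j := by simp; omega
    simp [rayPt, List.getElem?_eq_none hr, List.getElem?_eq_none hz, List.getElem?_eq_none hl]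

/-- Transport of the frame along the whole A-half. -/
theorem transportA' {n : ℕ} (hn : 1 ≤ n) :
    prodA (n : ℚ) * frameMat (rayPt (betaA 0) n) = sA (n : ℚ) • frameMat (bRecord n) := by
  rw [bRecord_eq_rayPt, ← betaA_last]; exact transportA hn

/-- Transport of the frame along the whole B-half. -/
theorem transportB' {n : ℕ} (hn : 1 ≤ n) :
    prodB (n : ℚ) * frameMat (rayPt (betaA 0) n) = sB (n : ℚ) • frameMat (bRecord (n + 1)) := by
  rw [bRecord_eq_rayPt, ← rayPt_last, ← betaB_zero]; exact transportB hn

/-! ### 4. Non-vanishing of the scalars -/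

/-- The A-half scalar does not vanish for `ν ≥ 1`. -/
theorem sA_ne {n : ℕ} (hn : 1 ≤ n) : sA (n : ℚ) ≠ 0 := by
  rw [sA, chainScalar, Ne, List.prod_eq_zero_iff, List.mem_map]
  rintro ⟨k, hk, h0⟩
  exact gamma3_ne (ptChk_of_lowerChk (List.all_eq_true.1 chainA_chk k hk)) hn h0

/-- The B-half scalar does not vanish for `ν ≥ 1`. -/
theorem sB_ne {n : ℕ} (hn : 1 ≤ n) : sB (n : ℚ) ≠ 0 := by
  rw [sB, chainScalar, Ne, List.prod_eq_zero_iff, List.mem_map]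
  rintro ⟨k, hk, h0⟩
  rcases Nat.eq_zero_or_pos k with rfl | hk0
  · simp only [sigB, if_true] at h0
    exact hScale_det_ne (ptChk_of_hChk hB_chk) (prChk_of_hChk hB_chk) hn h0
  · obtain ⟨j, rfl⟩ : ∃ j, k = j + 1 := ⟨k - 1, by omega⟩
    simp only [sigB, Nat.add_one_ne_zero, if_false] at h0
    have hj : j ∈ List.range 20 := List.mem_range.2 (by have := List.mem_range.1 hk; omega)
    exact gamma3_ne (ptChk_of_dsChk (List.all_eq_true.1 chainB_chk j hj)) hn h0

/-- The coefficient frame at `bRecord n` is invertible (`n ≥ 1`). -/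
theorem frameMat_bRecord_det_ne {m : ℕ} (hm : 1 ≤ m) : (frameMat (bRecord m)).det ≠ 0 := by
  have h := ends_chk
  simp only [Bool.and_eq_true] at h
  rw [bRecord_eq_rayPt, ← betaA_last]
  exact frameMat_det_ne h.1 h.2 hm

/-- The A-half step product is invertible for `ν ≥ 1`. -/
theorem prodA_det_ne {n : ℕ} (hn : 1 ≤ n) : (prodA (n : ℚ)).det ≠ 0 := by
  have h := congrArg Matrix.det (transportA' hn)
  rw [Matrix.det_mul, Matrix.det_smul, Fintype.card_fin] at h
  intro h0
  rw [h0, zero_mul] at h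
  exact mul_ne_zero (pow_ne_zero 3 (sA_ne hn)) (frameMat_bRecord_det_ne hn) h.symm

/-- The chain scalar `c_n = sA(n) / (det Ã(n) · sB(n))`. -/
noncomputable def cRec (n : ℕ) : ℚ := sA (n : ℚ) / ((prodA (n : ℚ)).det * sB (n : ℚ))

/-- The connection scalar `c_n` does not vanish (`n ≥ 1`). -/
theorem cRec_ne {n : ℕ} (hn : 1 ≤ n) : cRec n ≠ 0 :=
  div_ne_zero (sA_ne hn) (mul_ne_zero (prodA_det_ne hn) (sB_ne hn))

/-! ### 5. The chain rule -/

/-- `(det Ã · sB) • T(b_{n+1}) = sA • P̃(n) • T(b_n)` — integral form, no division. -/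
theorem frame_chain_smul {n : ℕ} (hn : 1 ≤ n) :
    ((prodA (n : ℚ)).det * sB (n : ℚ)) • frameMat (bRecord (n + 1)) =
      sA (n : ℚ) • (Pgen (n : ℚ) * frameMat (bRecord n)) := by
  have h1 := transportA' hn
  have h2 := transportB' hn
  unfold Pgen
  have h3 : (prodA (n : ℚ)).det • frameMat (rayPt (betaA 0) n) =
      sA (n : ℚ) • ((prodA (n : ℚ)).adjugate * frameMat (bRecord n)) := by
    have := congrArg (fun M => (prodA (n : ℚ)).adjugate * M) h1
    rwa [← Matrix.mul_assoc, Matrix.adjugate_mul, smul_mul_assoc, Matrix.one_mul, Matrix.mul_smul] at this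
  calc ((prodA (n : ℚ)).det * sB (n : ℚ)) • frameMat (bRecord (n + 1))
      = (prodA (n : ℚ)).det • (prodB (n : ℚ) * frameMat (rayPt (betaA 0) n)) := by rw [h2, smul_smul]
    _ = prodB (n : ℚ) * ((prodA (n : ℚ)).det • frameMat (rayPt (betaA 0) n)) := by rw [Matrix.mul_smul]
    _ = sA (n : ℚ) • (prodB (n : ℚ) * (prodA (n : ℚ)).adjugate * frameMat (bRecord n)) := by
        rw [h3, Matrix.mul_smul, Matrix.mul_assoc]

/-- **The chain rule (rational frame).** `T(b_{n+1}) = c_n • P̃(n) • T(b_n)`, `n ≥ 1`. -/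
theorem frame_chain {n : ℕ} (hn : 1 ≤ n) :
    frameMat (bRecord (n + 1)) = cRec n • (Pgen (n : ℚ) * frameMat (bRecord n)) := by
  have h := frame_chain_smul hn
  have hne : (prodA (n : ℚ)).det * sB (n : ℚ) ≠ 0 := mul_ne_zero (prodA_det_ne hn) (sB_ne hn)
  calc frameMat (bRecord (n + 1))
      = ((prodA (n : ℚ)).det * sB (n : ℚ))⁻¹ • (((prodA (n : ℚ)).det * sB (n : ℚ)) • frameMat (bRecord (n + 1))) := by
        rw [smul_smul, inv_mul_cancel₀ hne, one_smul]
    _ = cRec n • (Pgen (n : ℚ) * frameMat (bRecord n)) := by rw [h, smul_smul, cRec, div_eq_inv_mul]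

/-! ### 6. The real frame -/

/-- The real frame at `bRecord n` is the cast of the rational frame. -/
theorem realFrame_bRecord {m : ℕ} (hm : 1 ≤ m) :
    realFrame (bRecord m) = (frameMat (bRecord m)).map ((↑) : ℚ → ℝ) * gMat := by
  have h := ends_chk
  simp only [Bool.and_eq_true] at h
  obtain ⟨Pbox, Pd, -, P7, -⟩ := ptChk_sound h.1 hm
  rw [bRecord_eq_rayPt, ← betaA_last]
  exact realFrame_eq _ Pbox (by linarith) (by linarith)

/-- The real frame at `bRecord n` is invertible (`n ≥ 1`). -/
theorem realFrame_bRecord_det_ne {m : ℕ} (hm : 1 ≤ m) : (realFrame (bRecord m)).det ≠ 0 := by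
  have h := ends_chk
  simp only [Bool.and_eq_true] at h
  obtain ⟨Pbox, Pd, -, P7, -⟩ := ptChk_sound h.1 hm
  rw [bRecord_eq_rayPt, ← betaA_last, realFrame_det _ Pbox (by linarith) (by linarith), neg_ne_zero, Rat.cast_ne_zero,
    ← frameMat_det]
  exact frameMat_det_ne h.1 h.2 hm

/-- `Matrix.map` of `c • (M * T)` along a ring hom. -/
theorem map_smul_mul (c : ℚ) (P T : Matrix (Fin 3) (Fin 3) ℚ) :
    (c • (P * T)).map ((↑) : ℚ → ℝ) = (c : ℝ) • (P.map ((↑) : ℚ → ℝ) * T.map ((↑) : ℚ → ℝ)) := by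
  ext i j
  simp [Matrix.mul_apply, Fin.sum_univ_three]

/-- **The chain rule (real frame).** `T_ℝ(b_{n+1}) = c_n • P̃(n) • T_ℝ(b_n)` for `n ≥ 1` — hypothesis `hstep` of
`RecordRayConnection.frequently_ne_zero_of_window` on the record ray, with `P n = (Pgen n).map (↑)`. -/
theorem realFrame_chain {n : ℕ} (hn : 1 ≤ n) :
    realFrame (bRecord (n + 1)) = (cRec n : ℝ) • ((Pgen (n : ℚ)).map ((↑) : ℚ → ℝ) * realFrame (bRecord n)) := by
  rw [realFrame_bRecord (by omega : 1 ≤ n + 1), realFrame_bRecord hn, frame_chain hn, map_smul_mul, smul_mul_assoc,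
    Matrix.mul_assoc]

end Summit.KontsevichZagierPeriods.Zeta5Search.RecordRay.Generic
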